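import Summits.BirchSwinnertonDyer.BirchSwinnertonDyer.Theses.BiquadraticEisensteinDescent
import Summits.BirchSwinnertonDyer.BirchSwinnertonDyer.Theorems.BiquadraticEisensteinDescentHeegnerTwistCouplingInSupplySizeIndivisible
import Summits.BirchSwinnertonDyer.BirchSwinnertonDyer.Theorems.BiquadraticEisensteinDescentHeegnerTwistCouplingInSupplyLtIndivisible
import Summits.BirchSwinnertonDyer.BirchSwinnertonDyer.Theorems.BiquadraticEisensteinDescentHeegnerTwistCouplingInSupplyDensityOneSwitch
import Literature.NumberTheory.NumberFields.ClassNumberCrudeBound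
import HarnessLib

/-!
# Skeleton `size-tail` (v4) for crux `HeegnerTwistCouplingInSupply` (stmt-BirchSwinnertonDyer-21381, BED r503)

v4 (lead `bsd-line-ibd-p1` g2, 2026-08-28): the TAIL is RESHAPED by the DENSITY-ONE SWITCH (crux idea card
`goldfeld-density-one-switch`, crux-ideate seat 2 g8; landed glue p610230
`…Theorems.BiquadraticEisensteinDescentHeegnerTwistCouplingInSupplyDensityOneSwitch.heegnerTwistCouplingInSupply_of_nonNull`,
imported): the `L`-half `L(W^{(d)},1) ≠ 0` holds for Heegner `d` OFF A NULL SET of square-free `d` (Smith's `2^∞`-Selmer law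
+ Heegner sign + Monsky `2`-parity + Burungale–Tian's rank-zero `2`-converse for the CM twist + continuation from modularity),
so NO coupling is needed: a density-one set meets every non-null set. The open tail stub `stub_tailCouplingSharp` (v3: the
coupling on the sharp tail, crux-sized) is REPLACED by two registered stubs —
`stub_printedInputsDensityOne` (the four PRINT INPUTS by name: Modularity `exists_isNewformOf`, Burungale–Tian 2026 Thm 1.1,
Monsky's `2`-parity, Smith's law for CM curves — HELD, closable only by formalisation, never a worker target) and
`stub_nonNullIndivisibleHeegner` = C⁺ (W-free, `L`-free: for every level `N ≠ 0` and prime `p ≥ 5` the `p`-indivisible Heegner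
discriminants of level `N` are NOT a `twistDensity`-null set — OPEN for `p ≥ 5`; Cohen–Lenstra-type; in print only at `ℓ = 3`)
— and the PROVED `tailCouplingSharp_of_switch` (the v3 tail statement from the two stubs via the landed glue). The bulk branch
(`h(K′) < p`, stubs `stub_sizeIndivisible` p595406 / `stub_ltIndivisible` p607334) is unchanged. lean rc 0; sorries 2 = the two
stubs; `HeegnerTwistCouplingInSupply_of` concludes the route decl BY NAME. As typed (no print-input antecedents) the crux can
close only when `stub_printedInputsDensityOne` is a theorem (i.e. never before modularity is formalised): the planner's move is a
SPLIT «print inputs (held) + C⁺ (crux) ⇒ 21381» glued by p610230. BSD is not proved by any of this.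

v3 (lead `bsd-line-ibd-p1` g0, 2026-08-28, later the same session): SHARP bulk — the case split is on the CLASS NUMBER itself
(`h(K′) < p`, lever (L-A)), not on the Minkowski proxy `121·|d_K′| < p` (which is vacuous for every `p < 847`): stubs
`stub_ltIndivisible` (trivial) + `stub_tailCouplingSharp` (the coupling on the sharp tail); `stub_sizeIndivisible` stays as the
landed v1 stub (imported, subsumed via `classNumber_lt_of_small_discr`).
v2 (lead `bsd-line-ibd-p1` g0, 2026-08-28): `stub_sizeIndivisible` is no longer a sorry — it is the LANDED theorem
`…Theorems.BiquadraticEisensteinDescentHeegnerTwistCouplingInSupplySizeIndivisible.stub_sizeIndivisible` (p595406,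
cm-bed-p1 g0) imported and restated by `exact`; stubs unchanged by name and signature; sorries 2 → 1 (the one open
stub is `stub_tailCoupling`, the coupling on the tail sub-class = the crux's research content). Composition
`HeegnerTwistCouplingInSupply_of` unchanged (concludes the route decl BY NAME).

Crux-plan written by the row-12 lead `bsd-wall-cm-bed-p1` g0 (2026-08-28, D-0152 M1: one crux-plan before any
prover on a crux without a `Lines/` file). It TYPES the structural verdict of crux-ideate round 1 (seat 1 g3,
`OBSTRUCTIONS-seat1-g3.md` §G7 BULK/TAIL; seat 2 g4): `p ∤ h(K′)` is FREE BY SIZE whenever a Heegner field of small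
discriminant carries a non-vanishing twist, so the crux splits into

* `stub_sizeIndivisible` (S, PROVABLE NOW from the tree theorem
  `Literature.NumberTheory.NumberFields.classNumber_le_pow_mul_natAbs_discr`: `h_K ≤ 11^{n_K}|d_K|`):
  an imaginary quadratic `K′` with `121·|d_K′| < p` has `p ∤ h(K′)` — the kernel form of «h(d) < p below the size
  threshold» (print strength `|d| < c·p²/log²p` via the class number formula would widen the bulk; the crude bound
  is what the tree proves today);
* `stub_tailCoupling` (XL, THE RESEARCH CONTENT): the crux on the sub-class where NO Heegner field `K′` of `N_W`
  with `4 < |d_K′|`, `121·|d_K′| < p` has `L(W^{(d_K′)}, 1) ≠ 0` — i.e. every size-small Heegner twist vanishes or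
  none exists (the TAIL: fixed small `p`, `N₀ → ∞`; plus the conjecturally rare bulk pairs all of whose small
  Heegner twists vanish). Here a genuine COUPLING of twist non-vanishing with `p`-indivisibility of `h(d′)` is
  needed (engine census v1.3: no printed engine; Kriz–Li needs `E[p]` reducible; candidate layer 2 = card
  `linear-sturm-legendre-residue` ((R*) + Rubin–Bernoulli switch K1) for the `d_K = −7` sub-corner, typed in
  `SketchIdeasG3.lean`);

and the composition `HeegnerTwistCouplingInSupply_of` is the case split. The partition is TRUTH-PRESERVING (the tail
stub is the crux restricted by an extra hypothesis) — this line is a FRAME for width seats (instance certificates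
land pairs in the size branch; the size lemma lands now), not a proof strategy for the tail.
lean rc 0, sorries 1 (v3.1: `stub_ltIndivisible` landed p607334 and imported; the only sorry is `stub_tailCouplingSharp`). BSD is not proved by any of this.
-/

set_option linter.dupNamespace false
set_option autoImplicit false

noncomputable section

open scoped Classical NumberField

open WeierstrassCurve NumberField
  Literature.NumberTheory.EllipticCurves Literature.NumberTheory.EllipticCurves.Rank1Residual

namespace Summit.BirchSwinnertonDyer.BirchSwinnertonDyer.Cruxes.HeegnerTwistCouplingInSupply.SizeTail

open Summit.BirchSwinnertonDyer.BirchSwinnertonDyer.Theses.BiquadraticEisensteinDescent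

/-- STUB `stub_sizeIndivisible` (S — LANDED p595406, v2 imports it): an imaginary quadratic field `K′` with `121·|d_K′| < p` has
`p ∤ h(K′)`, because `1 ≤ h(K′) ≤ 11²·|d_K′| < p` (tree theorem `classNumber_le_pow_mul_natAbs_discr`,
Minkowski). The kernel form of the SIZE lever «`h(d′) < p` for `|d′|` below the threshold»; print strength
(`h(d) ≤ √|d|(ln|d|+1)/π`, class number formula) would replace `121·|d|` by `≍ √|d| log|d|`. -/
theorem stub_sizeIndivisible :
    ∀ (p : ℕ) [Fact p.Prime] (K : Type) [Field K] [NumberField K],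
      IsImaginaryQuadratic K → 121 * (NumberField.discr K).natAbs < p → ¬ p ∣ NumberField.classNumber K :=
  -- v2: LANDED (p595406) — the registered stub by name and signature, imported.
  Summit.BirchSwinnertonDyer.BirchSwinnertonDyer.Theorems.BiquadraticEisensteinDescentHeegnerTwistCouplingInSupplySizeIndivisible.stub_sizeIndivisible

/-- STUB `stub_ltIndivisible` (v3, S — LANDED p607334, v3.1 imports it; the SHARP form of the size lever «h(K′) < p»): a number field whose
class number is `< p` has class number prime to `p` (`0 < h`). This is lever (L-A) of the PRESEARCH dossier in kernel
form; it subsumes `stub_sizeIndivisible` (`121·|d| < p ⇒ h ≤ 121·|d| < p`) and is met by 51/72 CORE census pairs on a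
recorded Heegner field (KS-INSTANCE-TABLE-21381-g11). -/
theorem stub_ltIndivisible :
    ∀ (p : ℕ) (K : Type) [Field K] [NumberField K],
      NumberField.classNumber K < p → ¬ p ∣ NumberField.classNumber K :=
  -- v3.1: LANDED (p607334) — the registered stub by name and signature, imported.
  Summit.BirchSwinnertonDyer.BirchSwinnertonDyer.Theorems.BiquadraticEisensteinDescentHeegnerTwistCouplingInSupplyLtIndivisible.stub_ltIndivisible

/-- STUB `stub_printedInputsDensityOne` (v4 — PRINT INPUTS, HELD; never a worker target): the four named facts the
density-one switch consumes, BY NAME — the Modularity Theorem (`exists_isNewformOf`, BCDT 2001 Thm. A; BED item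
`ModularityNewformExists`), the Burungale–Tian rank-zero `p`-converse for CM curves over `ℚ` (Ann. of Math. 203 (2026) Thm. 1.1),
Monsky's `2`-parity (Dokchitser–Dokchitser 2010 §4.6), and Smith's `2^∞`-Selmer corank law for every CM curve over `ℚ`
(arXiv:2503.17619 Thm. 1.1; for CM `j ≠ 8000` derived in the tree from the refereed J. Amer. Math. Soc. 39 (2026) theorems,
`BSDSelmerSmithCMTableProofs`; for every curve via `smith_selmerCorank_density_holds_of` from Smith 2022 + Thm. 1.17 IV/V).
Closable only by formalising those sources; a planner SPLIT files them as auto-HELD print-input children. -/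
theorem stub_printedInputsDensityOne :
    ModularForms.exists_isNewformOf ∧
      burungaleTian_analyticRank_eq_zero_of_selmerCorank_eq_zero_of_hasCM ∧
      monsky_selmerCorank_two_mod_two_eq ∧
      (∀ (W : WeierstrassCurve ℚ) [W.IsElliptic], W.HasCM → smith_selmerCorank_density W) := by
  sorry

/-- STUB `stub_nonNullIndivisibleHeegner` = C⁺ (v4 — THE RESEARCH CONTENT of the line after the switch; W-free and
`L`-free): for every level `N ≠ 0` and every prime `p ≥ 5`, the set of integers `d` that are discriminants of imaginary
quadratic fields `K` with `|d| > 4`, every prime factor of `N` split in `K` (Heegner hypothesis) and `p ∤ h_K` is NOT a null set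
of square-free integers (tree currency `twistDensity`, both signs, ordered by `|d|`). Status: OPEN for every `p ≥ 5` — the
weakest Cohen–Lenstra-type LOWER-density statement for `p ∤ h` in a split box (Kohnen–Ono 1999 Thm. 1 gives `≫ √X/log X`
such `d`, not non-nullity; Beckwith–Raum–Richter IMRN 2024 Thm. 1 gives existence with splitting conditions; positive
proportion with local conditions is in print only at `ℓ = 3`: Davenport–Heilbronn, Nakagawa–Horie, Bhargava–Shankar–Tsimerman).
Sufficient: any positive `twistDensity` (`DensityOneSwitch.not_twistDensity_zero_of_twistDensity_pos`), e.g. a bounded first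
moment `mean #Cl(d)[p] < p` over the Heegner box (Cohen–Lenstra predicts 2). Numerically (card falsifier, |d| ≤ 1.5·10⁵):
proportion 0.77–0.92 in every box, flat in X. -/
theorem stub_nonNullIndivisibleHeegner :
    ∀ (N p : ℕ), N ≠ 0 → p.Prime → 5 ≤ p →
      ¬ twistDensity (fun d : ℤ ↦ ∃ (K : Type) (_ : Field K) (_ : NumberField K),
        IsImaginaryQuadratic K ∧ NumberField.discr K = d ∧ 4 < d.natAbs ∧
        SatisfiesHeegnerHypothesis N K ∧ ¬ p ∣ NumberField.classNumber K) 0 := by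
  sorry

/-- THE v3 TAIL STATEMENT, now PROVED from the two v4 stubs by the landed density-one glue (p610230): for `(W, p)` in the
corner with the ∀B class-number supply, even if every Heegner `K′` of `N_W` with `4 < |d_K′|` and `h(K′) < p` has a vanishing
twist, some Heegner `K′` with `4 < |d_K′|`, `L(W^{(d_K′)},1) ≠ 0` and `p ∤ h(K′)` exists. (Signature = the v3 registered stub
`stub_tailCouplingSharp` verbatim; the tail hypothesis and the supply family are no longer used.) -/
theorem tailCouplingSharp_of_switch :
    ∀ (W : WeierstrassCurve ℚ) [W.IsElliptic] [W.IsGloballyMinimal] (p : ℕ) [Fact p.Prime]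
      [NeZero (W.conductorNorm ℤ)],
      W.HasCM → W.analyticRank = 1 → 5 ≤ p → CMInert W p → ¬ Good W p →
      (∀ B : ℕ, ∃ (K : Type) (_ : Field K) (_ : NumberField K), IsImaginaryQuadratic K ∧
        B < (NumberField.discr K).natAbs ∧ 4 < (NumberField.discr K).natAbs ∧
        SatisfiesHeegnerHypothesis (W.conductorNorm ℤ) K ∧ ¬ p ∣ NumberField.classNumber K) →
      (∀ (K : Type) [Field K] [NumberField K], IsImaginaryQuadratic K → 4 < (NumberField.discr K).natAbs →
        SatisfiesHeegnerHypothesis (W.conductorNorm ℤ) K → NumberField.classNumber K < p →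
        (W.quadraticTwist (NumberField.discr K : ℚ)).entireLFunction 1 = 0) →
      ∃ (K : Type) (_ : Field K) (_ : NumberField K), IsImaginaryQuadratic K ∧
        4 < (NumberField.discr K).natAbs ∧ SatisfiesHeegnerHypothesis (W.conductorNorm ℤ) K ∧
        (W.quadraticTwist (NumberField.discr K : ℚ)).entireLFunction 1 ≠ 0 ∧
        ¬ p ∣ NumberField.classNumber K := by
  intro W _ _ p _ _ hCM hr hp5 hin hbad hsup _
  obtain ⟨hmod, hBT, hMon, hS⟩ := stub_printedInputsDensityOne
  exact Summit.BirchSwinnertonDyer.BirchSwinnertonDyer.Theorems.BiquadraticEisensteinDescentHeegnerTwistCouplingInSupplyDensityOneSwitch.heegnerTwistCouplingInSupply_of_nonNull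
    hmod hBT hMon hS stub_nonNullIndivisibleHeegner W p hCM hr hp5 hin hbad hsup

/-- COMPOSITION (kernel-checked; v4): the crux `HeegnerTwistCouplingInSupply` — THE ROUTE DECL BY NAME — by the SHARP
BULK/TAIL case split: if some Heegner `K′` with `4 < |d_K′|` and `h(K′) < p` carries a non-vanishing twist, `stub_ltIndivisible`
gives `p ∤ h(K′)`; otherwise the tail, now PROVED from the v4 stubs through the density-one switch (`tailCouplingSharp_of_switch`). -/
theorem HeegnerTwistCouplingInSupply_of : HeegnerTwistCouplingInSupply := by
  intro W _ _ p _ _ hCM hr hp5 hin hbad hsup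
  by_cases h : ∃ (K : Type) (_ : Field K) (_ : NumberField K), IsImaginaryQuadratic K ∧
      4 < (NumberField.discr K).natAbs ∧ SatisfiesHeegnerHypothesis (W.conductorNorm ℤ) K ∧
      NumberField.classNumber K < p ∧ (W.quadraticTwist (NumberField.discr K : ℚ)).entireLFunction 1 ≠ 0
  · obtain ⟨K, _, _, hK, hd4, hHN, hsmall, hL⟩ := h
    exact ⟨K, inferInstance, inferInstance, hK, hd4, hHN, hL, stub_ltIndivisible p K hsmall⟩
  · refine tailCouplingSharp_of_switch W p hCM hr hp5 hin hbad hsup ?_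
    intro K _ _ hK hd4 hHN hsmall
    by_contra hL
    exact h ⟨K, inferInstance, inferInstance, hK, hd4, hHN, hsmall, hL⟩

/-- The v1/v2 bulk is contained in the v3 bulk: `121·|d_K′| < p ⇒ h(K′) < p` (tree Minkowski bound
`classNumber_le_pow_mul_natAbs_discr`, through the landed `stub_sizeIndivisible`'s proof shape). Bookkeeping. -/
theorem classNumber_lt_of_small_discr (p : ℕ) (K : Type) [Field K] [NumberField K]
    (hK : IsImaginaryQuadratic K) (hlt : 121 * (NumberField.discr K).natAbs < p) :
    NumberField.classNumber K < p := by
  have hle := Literature.NumberTheory.NumberFields.classNumber_le_pow_mul_natAbs_discr K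
  rw [hK.1] at hle
  omega

end Summit.BirchSwinnertonDyer.BirchSwinnertonDyer.Cruxes.HeegnerTwistCouplingInSupply.SizeTail

end
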